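import Summits.BirchSwinnertonDyer.BirchSwinnertonDyer.Theorems.PrintCf2SplitBadTwoCyclicInfResSign
import Summits.BirchSwinnertonDyer.BirchSwinnertonDyer.Theorems.PrintCf2SplitBadTwoCyclicInfResSelmer
import Literature.NumberTheory.EllipticCurves.H1TrivialAction
import Literature.NumberTheory.EllipticCurves.Rubin1991.TwoVariableSelmerCoefficientTwist
import HarnessLib

/-!
# `U_∞/𝒞_∞` f.g. torsion by weak Leopoldt, IV (input (X2) of the frame `[K₀K̃_∞ : K̃_∞] = 2`), file 1: THE INDEX-`2` TRANSFER
# for a module with TRIVIAL action — `2 · res⁻¹(Sel(H′)) ≤ Sel(H)` and `res⁻¹(Sel(H′)) ≤ H¹(K_Σ/K̄^H)` for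
# `H′ = H ⊓ ker θ`, `θ² = 1`

Cell `bsd-print-cf2`, width seat `bsd-line-cf2c-w3` g11, `--supports` the DECIDING research child
`PrintCf2RubinValueTwo.MainConjClauseAtSplitTwoQuadDA` (stmt-BirchSwinnertonDyer-24721; `m_line_pin` v1.4 / `m_line_pin_class` v2.1 content
stub `stub_unitsQuotient`, slice `[K₀ : K] = 2`) as a helper. PURPOSE: cf2c-w5 g9's `LeopoldtAtV.isFG_and_isTorsion_semilocalUnitData₂_frame_two`
(`…LeopoldtUnitsFGTorsionFrameTwo`, p728561) displays ONE research input without a typed home, (X2): the character module of the `θ`-EIGEN Selmer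
classes `S₃ ≤ Sel(𝔎_∞, A_θ)` (`𝔎_∞ = K_θK̃_∞`, `H′ = Gal(K̄/𝔎_∞) = pairKer ⊓ ker θ`) is f.g. torsion over `Λ₂`. This series (files 1–3) proves
(X2) from «the dual of `H¹_nr(K̃_∞, A_{θ₁})` is `Λ₂`-torsion for the TRIVIAL character `θ₁`» (Rubin 1991 Thm. 5.3 (iii) shape). The mechanism
(Greenberg LNM 1716 §3; Rubin 1991 §4): under the coefficient switch `A_θ|_{H′} = A_{θ₁}|_{H′}` the `θ`-eigen classes are the `H`-INVARIANT classes
of `Sel(H′, A_{θ₁})`; those all come by restriction from `H¹(H, A_{θ₁})` (`Ĥ⁰ = 0`: `ℚ_p/ℤ_p` is divisible); and THIS FILE controls the local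
conditions of the lifts: for a discrete `Γ_K`-module `M` on which `Γ_K` acts TRIVIALLY, a subgroup `H ≤ Γ_K` and `H′ = H ⊓ ker χ` for a
`ℤ_pˣ`-valued character `χ` with `χ² = 1` (here `χ = unitChar θ`),
* §1 `two_nsmul_eq_zero_of_resOfLe_eq_zero` (pure group cohomology, any topological group): a class of `H¹(H₁, M)` (`M` trivial) that dies on a
  subgroup `H₂` containing all squares is killed by `2` (`H¹ = Hom`, `2·f(x) = f(x²)`);
* §2 `two_nsmul_mem_unramifiedKer_of_resOfLe_mem`, `two_nsmul_mem_greenbergKer_of_resOfLe_mem` — at EVERY finite place `w` (also the ramified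
  places of `θ`): if `res_{H′} z` satisfies the unramified / Greenberg condition at `w` then `2·z` does (`[H ⊓ I_w : H′ ⊓ I_w] ≤ 2`);
  **`two_nsmul_mem_datumSelmer_of_resOfLe_mem`** — for every Greenberg datum `L` and `S₀`: `res z ∈ Sel_L^{S₀}(H′) ⟹ 2·z ∈ Sel_L^{S₀}(H)`;
* §3 `mem_unramifiedKer_of_resOfLe_mem_of_inf_inertia_le` (any `M`): at a place where `H ⊓ I_w ≤ H′` (`θ` unramified) the condition transfers
  back exactly; **`mem_unramifiedOutside_of_resOfLe_mem_datumSelmer`** — `res z ∈ Sel_L^{∅}(H′) ⟹ z ∈ H¹(K_Σ/K̄^H, M)` for `Σ ⊇` the places where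
  `H ⊓ I_w ≰ H′`.
So `Y := res⁻¹(Sel(H′))` sits between `Sel(H)` and `½·Sel(H)` inside `H¹(K_Σ/K̃_∞, M)`: its character module is an extension of a submodule of
the dual of `Sel(H)` by a module killed by `2`, and it is finitely generated by Nakayama (files 2–3). THEOREMS ONLY (no `def`, no named fact, no
`sorry`); Theses-free; any number field, any prime. HONEST FRAMING: nothing here closes the crux or a registered stub; no summit statement is
proved by this seat; BSD is not proved by any of this.

References: R. Greenberg, LNM 1716 (1999) §3 Lemmas 3.1–3.2, §4 p. 107 [GreenbergLNM1716]; K. Rubin, Invent. Math. 103 (1991) §4 (5) p. 36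
[Rubin1991]; R. Greenberg, V. Vatsal, Invent. Math. 142 (2000) §2 pp. 16–17, 20 [GreenbergVatsal2000]; J.-P. Serre, *Galois Cohomology*
I §2.3–2.4 [SerreGaloisCohomology1997].
-/

noncomputable section

open scoped Classical

set_option linter.dupNamespace false -- D-0017: `…BirchSwinnertonDyer.BirchSwinnertonDyer…` repeats a namespace by design
set_option autoImplicit false

open NumberField IsDedekindDomain Field
open Literature.NumberTheory.EllipticCurves Literature.NumberTheory.EllipticCurves.GreenbergSelmer
open Literature.NumberTheory.EllipticCurves.GreenbergVatsal2000 Literature.NumberTheory.EllipticCurves.Castella2018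
open Literature.NumberTheory.GaloisRepresentations
open Summit.BirchSwinnertonDyer.BirchSwinnertonDyer.Theorems.IwasawaTwoVariable
open Summit.BirchSwinnertonDyer.BirchSwinnertonDyer.Theorems.PrintCf2.CyclicInfRes

namespace Summit.BirchSwinnertonDyer.BirchSwinnertonDyer.Theorems.PrintCf2.EigenSelmerTransfer

universe u

/-! ## §1. Pure group cohomology: a class of a trivial module dying on a subgroup containing the squares is killed by `2` -/

section Trivial

variable {G : Type u} [Group G] [TopologicalSpace G] [IsTopologicalGroup G]
  {M : Type u} [AddCommGroup M] [DistribMulAction G M] [TopologicalSpace M] [DiscreteTopology M]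

/-- Restriction along `H₂ ≤ H₁` commutes with the evaluation homomorphisms of `H¹ = Hom` (trivial action):
`(res z)(x) = z(x)`. [cite: SerreGaloisCohomology1997, I §2.3 Remark, I §2.4] -/
theorem evalH1_resOfLe {H₁ H₂ : Subgroup G} (hle : H₂ ≤ H₁) (h₁ : ∀ (x : H₁) (m : M), x • m = m)
    (h₂ : ∀ (x : H₂) (m : M), x • m = m) (z : subgroupH1 H₁ M) (x : H₂) :
    evalH1 h₂ x (resOfLe M hle z) = evalH1 h₁ ⟨x, hle x.2⟩ z := by
  obtain ⟨ξ, rfl⟩ := oneCocycleClass_surjective _ z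
  rw [CyclicInfRes.resOfLe_oneCocycleClass, evalH1_oneCocycleClass, evalH1_oneCocycleClass]
  rfl

/-- **A class of `H¹(H₁, M)`, `M` with trivial action, whose restriction to a subgroup `H₂` containing every square `x²`, `x ∈ H₁`,
vanishes, is killed by `2`**: `H¹ = Hom` and `2·f(x) = f(x²) = 0`. [cite: SerreGaloisCohomology1997, I §2.3 Remark] -/
theorem two_nsmul_eq_zero_of_resOfLe_eq_zero {H₁ H₂ : Subgroup G} (hle : H₂ ≤ H₁) (h₁ : ∀ (x : H₁) (m : M), x • m = m)
    (hsq : ∀ x ∈ H₁, x * x ∈ H₂) (z : subgroupH1 H₁ M) (hz : resOfLe M hle z = 0) : 2 • z = 0 := by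
  have h₂ : ∀ (x : H₂) (m : M), x • m = m := fun x m ↦ h₁ ⟨x, hle x.2⟩ m
  refine ext_of_trivial h₁ fun x ↦ ?_
  have key : evalH1 h₁ (x * x) z = 0 := by
    have e := evalH1_resOfLe hle h₁ h₂ z ⟨x * x, hsq x x.2⟩
    rw [hz, map_zero] at e
    rw [show (x * x : H₁) = ⟨((⟨(x : G) * x, hsq x x.2⟩ : H₂) : G), hle (hsq x x.2)⟩ from Subtype.ext rfl]
    exact e.symm
  change evalH1 h₁ x (2 • z) = evalH1 h₁ x 0
  rw [map_nsmul, map_zero, two_nsmul, ← evalH1_mul, key]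

end Trivial

/-! ## §2. At every finite place: `res_{H′} z` unramified / Greenberg ⟹ `2·z` unramified / Greenberg (`H′ = H ⊓ ker χ`, `χ² = 1`) -/

section Local

variable {K : Type u} [Field K] [NumberField K] {p : ℕ} [Fact p.Prime] (H : Subgroup (absoluteGaloisGroup K))
  (χ : absoluteGaloisGroup K →ₜ* ℤ_[p]ˣ)
  {M : Type u} [AddCommGroup M] [DistribMulAction (absoluteGaloisGroup K) M] [TopologicalSpace M] [DiscreteTopology M]

omit [NumberField K] in
/-- `H ⊓ ker χ ≤ H`. [folklore] -/
theorem inf_ker_le : H ⊓ χ.toMonoidHom.ker ≤ H := inf_le_left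

/-- For `χ² = 1`: the square of an element of `H ⊓ I_w` lies in `(H ⊓ ker χ) ⊓ I_w` (inside `D_w`). [folklore] -/
theorem mul_self_mem_inertiaIn (hχ : ∀ σ : absoluteGaloisGroup K, χ σ ^ 2 = 1) (w : HeightOneSpectrum (𝓞 K))
    (x : ↥(decomp (K := K) w)) (hx : x ∈ inertiaIn H w) : x * x ∈ inertiaIn (H ⊓ χ.toMonoidHom.ker) w := by
  rw [mem_inertiaIn_iff] at hx ⊢
  refine ⟨Subgroup.mem_inf.mpr ⟨H.mul_mem hx.1 hx.1, ?_⟩, (inertia w).mul_mem hx.2 hx.2⟩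
  show χ ((x : absoluteGaloisGroup K) * x) = 1
  rw [map_mul, ← sq, hχ]

/-- **`res_{H ⊓ ker χ} z` unramified at (the chosen place above) `w` ⟹ `2·z` unramified there**, for `M` with trivial `Γ_K`-action and
`χ² = 1`: the restriction of `z` to `H ⊓ I_w` dies on `(H ⊓ ker χ) ⊓ I_w ∋` all squares (`resH1Hom_inertiaIn_resOfLe_id`, §1).
[cite: GreenbergVatsal2000, §2 p. 17] [cite: GreenbergLNM1716, §3 Lemma 3.1] -/
theorem two_nsmul_mem_unramifiedKer_of_resOfLe_mem (hχ : ∀ σ : absoluteGaloisGroup K, χ σ ^ 2 = 1)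
    (htriv : ∀ (σ : absoluteGaloisGroup K) (m : M), σ • m = m) (w : HeightOneSpectrum (𝓞 K)) (z : subgroupH1 H M)
    (hz : resOfLe M (inf_ker_le H χ) z ∈ unramifiedKer (H ⊓ χ.toMonoidHom.ker) M w) : 2 • z ∈ unramifiedKer H M w := by
  have hz' : resH1Hom (inertiaInToH (H ⊓ χ.toMonoidHom.ker) w) (AddMonoidHom.id M) (id_smul_inertiaInToH _ w)
      (resOfLe M (inf_ker_le H χ) z) = 0 := hz
  rw [resH1Hom_inertiaIn_resOfLe_id] at hz'
  have h2 := two_nsmul_eq_zero_of_resOfLe_eq_zero (G := ↥(decomp (K := K) w)) (M := M)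
    (inertiaIn_mono (inf_ker_le H χ) w) (fun x m ↦ htriv _ m) (fun x hx ↦ mul_self_mem_inertiaIn H χ hχ w x hx) _ hz'
  change resH1Hom (inertiaInToH H w) (AddMonoidHom.id M) (id_smul_inertiaInToH H w) (2 • z) = 0
  rw [map_nsmul, h2]

/-- **The same for Greenberg's inertia condition at `w ∣ p`** for any local datum `N = M⁺_w` (coefficients `M ⧸ M⁺_w`, on which `D_w` acts
trivially as well; `greenbergMap_resOfLe`). [cite: Greenberg1989, §1 p. 98 (4)] [cite: GreenbergLNM1716, §3 Lemma 3.1] -/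
theorem two_nsmul_mem_greenbergKer_of_resOfLe_mem (hχ : ∀ σ : absoluteGaloisGroup K, χ σ ^ 2 = 1)
    (htriv : ∀ (σ : absoluteGaloisGroup K) (m : M), σ • m = m) {w : HeightOneSpectrum (𝓞 K)} (N : LocalDatum K M w)
    (z : subgroupH1 H M) (hz : resOfLe M (inf_ker_le H χ) z ∈ N.greenbergKer (H ⊓ χ.toMonoidHom.ker)) :
    2 • z ∈ N.greenbergKer H := by
  rw [LocalDatum.mem_greenbergKer_iff, greenbergMap_resOfLe] at hz
  have htrivGr : ∀ (x : ↥(inertiaIn H w)) (m : N.Gr), x • m = m := by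
    intro x m
    obtain ⟨m, rfl⟩ := N.grMk_surjective m
    change ((x : ↥(decomp (K := K) w)) • N.grMk m) = N.grMk m
    rw [LocalDatum.smul_grMk]
    exact congrArg N.grMk (htriv _ m)
  have h2 := two_nsmul_eq_zero_of_resOfLe_eq_zero (G := ↥(decomp (K := K) w)) (M := N.Gr)
    (inertiaIn_mono (inf_ker_le H χ) w) htrivGr (fun x hx ↦ mul_self_mem_inertiaIn H χ hχ w x hx) _ hz
  rw [LocalDatum.mem_greenbergKer_iff, map_nsmul, h2]

variable [H.Normal]

omit [NumberField K] in
/-- `H ⊓ ker χ` is normal in `Γ_K` (intersection of normal subgroups; `ℤ_pˣ` is abelian). [folklore] -/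
theorem normal_inf_ker : (H ⊓ χ.toMonoidHom.ker).Normal := by
  haveI : (χ.toMonoidHom).ker.Normal := MonoidHom.normal_ker _
  infer_instance

/-- **`res_{H ⊓ ker χ} z ∈ Sel_L^{S₀}(H ⊓ ker χ) ⟹ 2·z ∈ Sel_L^{S₀}(H)`** for every Greenberg datum `L`, every `S₀`, `M` with trivial
`Γ_K`-action and `χ² = 1`: every local condition is imposed on every conjugate `conj_σ`, restriction commutes with `conj_σ`
(`resOfLe_conjH1_comm`) and with `2·`, and §2 applies place by place. [cite: GreenbergVatsal2000, §2 pp. 16–17, 20] [cite: GreenbergLNM1716, §3 Lemmas 3.1–3.2] -/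
theorem two_nsmul_mem_datumSelmer_of_resOfLe_mem (hχ : ∀ σ : absoluteGaloisGroup K, χ σ ^ 2 = 1)
    (htriv : ∀ (σ : absoluteGaloisGroup K) (m : M), σ • m = m) (L : Data K M p) (S₀ : Set (HeightOneSpectrum (𝓞 K)))
    (z : subgroupH1 H M)
    (hz : haveI := normal_inf_ker H χ
      resOfLe M (inf_ker_le H χ) z ∈ datumSelmer (H ⊓ χ.toMonoidHom.ker) M p L S₀) :
    2 • z ∈ datumSelmer H M p L S₀ := by
  haveI := normal_inf_ker H χ
  rw [mem_datumSelmer_iff, mem_unramifiedOutside_iff] at hz ⊢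
  refine ⟨fun w hw hpw σ ↦ ?_, fun w hpw σ ↦ ?_⟩
  · have h := hz.1 w hw hpw σ
    rw [← resOfLe_conjH1_comm] at h
    rw [map_nsmul]
    exact two_nsmul_mem_unramifiedKer_of_resOfLe_mem H χ hχ htriv w _ h
  · have h := hz.2 w hpw σ
    rw [← resOfLe_conjH1_comm] at h
    rw [map_nsmul]
    exact two_nsmul_mem_greenbergKer_of_resOfLe_mem H χ hχ htriv (L w hpw) _ h

end Local

/-! ## §3. At the places where `H ⊓ I_w ≤ H′`: exact transfer, and `res⁻¹(Sel(H′)) ≤ H¹(K_Σ/K̄^H, M)` -/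

section Outside

variable {K : Type u} [Field K] [NumberField K] {p : ℕ} {H' H : Subgroup (absoluteGaloisGroup K)}
  {M : Type u} [AddCommGroup M] [DistribMulAction (absoluteGaloisGroup K) M] [TopologicalSpace M] [DiscreteTopology M]

/-- **Where the two inertia groups agree the unramified condition transfers back exactly** (any `M`): if `H ⊓ I_w ≤ H′` then
`res_{H′} z ∈ ker(→ H¹(H′ ⊓ I_w)) ⟹ z ∈ ker(→ H¹(H ⊓ I_w))` (`resOfLe_injective_of_ge` on `H′ ⊓ I_w = H ⊓ I_w`; the place-wise half of the
tree's `IwasawaTwoVariable.mem_datumSelmer_of_resOfLe_mem`). [cite: GreenbergVatsal2000, §2 p. 17] -/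
theorem mem_unramifiedKer_of_resOfLe_mem_of_inf_inertia_le (hle : H' ≤ H) {w : HeightOneSpectrum (𝓞 K)} (hI : H ⊓ inertia w ≤ H')
    (z : subgroupH1 H M) (hz : resOfLe M hle z ∈ unramifiedKer H' M w) : z ∈ unramifiedKer H M w := by
  have h' : resH1Hom (inertiaInToH H' w) (AddMonoidHom.id M) (id_smul_inertiaInToH H' w) (resOfLe M hle z) = 0 := hz
  rw [resH1Hom_inertiaIn_resOfLe_id] at h'
  have hinj : Function.Injective (Literature.NumberTheory.EllipticCurves.resOfLe M (inertiaIn_mono hle w)) :=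
    resOfLe_injective_of_ge M (inertiaIn_mono hle w) (inertiaIn_le_of_inf_inertia_le w hI)
  exact (injective_iff_map_eq_zero _).1 hinj _ h'

variable [H'.Normal] [H.Normal]

/-- **`res⁻¹(Sel_L^{∅}(H′)) ≤ H¹(K_Σ/K̄^H, M)`** for any finite-or-not `Σ ⊇ {w ∤ p : H ⊓ I_w ≰ H′}`: a class of `H¹(H, M)` whose restriction to
`H′` satisfies the datum Selmer conditions (for ANY datum `L`, no relaxed places) is unramified at every `w ∉ Σ`, `w ∤ p`
(`unramifiedOutside H M p Σ`). For `H′ = H ⊓ ker θ` take `Σ =` the ramified places of `θ` away from `p`.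
[cite: GreenbergVatsal2000, §2 pp. 16–17, 23] [cite: GreenbergLNM1716, §4 p. 107] -/
theorem mem_unramifiedOutside_of_resOfLe_mem_datumSelmer (hle : H' ≤ H) (L : Data K M p)
    (S₁ : Set (HeightOneSpectrum (𝓞 K)))
    (hS₁ : ∀ w : HeightOneSpectrum (𝓞 K), w ∉ S₁ → ((p : ℕ) : 𝓞 K) ∉ w.asIdeal → H ⊓ inertia w ≤ H')
    (z : subgroupH1 H M) (hz : resOfLe M hle z ∈ datumSelmer H' M p L ∅) : z ∈ unramifiedOutside H M p S₁ := by
  rw [mem_unramifiedOutside_iff]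
  intro w hw hpw σ
  have h := ((mem_datumSelmer_iff _).1 hz).1
  rw [mem_unramifiedOutside_iff] at h
  have h' := h w (fun h0 ↦ h0) hpw σ
  rw [← resOfLe_conjH1_comm] at h'
  exact mem_unramifiedKer_of_resOfLe_mem_of_inf_inertia_le hle (hS₁ w hw hpw) _ h'

end Outside

end Summit.BirchSwinnertonDyer.BirchSwinnertonDyer.Theorems.PrintCf2.EigenSelmerTransfer

end
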